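import Summits.Parity.BatemanHorn.Theses.RoughValueTransport

/-!
# `BalancedSemiprimeLayer` (crux stmt-Parity-9469): structure of the statement

Negative-side structural facts (cdisprove, refuter-cdisprove-stmt-Parity-9469-g2-0), all PROVED:

* `card_cruxFilter_mono` — the crux's left-hand count `Φ_f(x, δ)` is monotone in `δ` (a smaller `δ`
  sifts further);
* `balancedSemiprimeLayer_iff_eventually_small` — hence the cap `δ ≤ 1/4` is immaterial and the
  crux is EQUIVALENT to: for every system and every `ε > 0` the inequality holds eventually for ALL
  sufficiently small `δ > 0` ("∃ δ" = "every small δ");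
* `cruxConclusion_fin_zero` — the `k = 0` slice (empty system) is TRUE (`x ≤ (x+1) + εx`), so the
  degenerate case is no refutation.
-/

namespace Summit.Parity.BatemanHorn.Theorems.BalancedSemiprimeLayer.Negative

open Filter Finset Polynomial Real
open Literature.NumberTheory.Sieve
open Summit.Parity.BatemanHorn.Theses.RoughValueTransport (BalancedSemiprimeLayer)

/-- `Φ_f(x, δ)` is monotone in `δ`. [folklore] -/
theorem card_cruxFilter_mono {k : ℕ} (f : Fin k → ℤ[X]) {δ₁ δ₂ : ℝ} (h : δ₁ ≤ δ₂) (x : ℕ) :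
    #((Icc 1 x).filter (fun n : ℕ => ∀ i, 0 < (f i).eval (n : ℤ) ∧
      ∀ p ∈ range ⌈(x : ℝ) ^ (((f i).natDegree : ℝ) * (1 - δ₁) / 2)⌉₊,
        p.Prime → ¬ ((p : ℤ) ∣ (f i).eval (n : ℤ)))) ≤
    #((Icc 1 x).filter (fun n : ℕ => ∀ i, 0 < (f i).eval (n : ℤ) ∧
      ∀ p ∈ range ⌈(x : ℝ) ^ (((f i).natDegree : ℝ) * (1 - δ₂) / 2)⌉₊,
        p.Prime → ¬ ((p : ℤ) ∣ (f i).eval (n : ℤ)))) := by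
  refine card_le_card fun n hn => ?_
  simp only [mem_filter, mem_Icc] at hn ⊢
  refine ⟨hn.1, fun i => ⟨(hn.2 i).1, fun p hp hpp => (hn.2 i).2 p ?_ hpp⟩⟩
  rw [mem_range] at hp ⊢
  refine lt_of_lt_of_le hp (Nat.ceil_mono ?_)
  have hx : (1 : ℝ) ≤ x := by exact_mod_cast hn.1.1.trans hn.1.2
  refine Real.rpow_le_rpow_of_exponent_le hx ?_
  have hd : (0 : ℝ) ≤ (f i).natDegree := Nat.cast_nonneg _
  nlinarith

/-- **The cap `δ ≤ 1/4` is immaterial; `∃ δ` means "all small `δ`"**: the crux is equivalent to the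
statement that for every Bateman–Horn system and every `ε > 0` there is `δ₀ > 0` such that for EVERY
`δ ∈ (0, δ₀]` the inequality holds eventually. [folklore] -/
theorem balancedSemiprimeLayer_iff_eventually_small :
    BalancedSemiprimeLayer ↔
      ∀ (k : ℕ) (f : Fin k → ℤ[X]), IsBatemanHornSystem f → ∀ ε : ℝ, 0 < ε →
        ∃ δ₀ : ℝ, 0 < δ₀ ∧ ∀ δ : ℝ, 0 < δ → δ ≤ δ₀ → ∀ᶠ x : ℕ in atTop,
          (((Icc 1 x).filter (fun n : ℕ => ∀ i, 0 < (f i).eval (n : ℤ) ∧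
            ∀ p ∈ range ⌈(x : ℝ) ^ (((f i).natDegree : ℝ) * (1 - δ) / 2)⌉₊,
              p.Prime → ¬ ((p : ℤ) ∣ (f i).eval (n : ℤ)))).card : ℝ) ≤
            (polyPrimeCount f x : ℝ) + ε * (x : ℝ) / Real.log x ^ k := by
  constructor
  · intro h k f hf ε hε
    obtain ⟨δ₀, hδ₀, -, hev⟩ := h k f hf ε hε
    refine ⟨δ₀, hδ₀, fun δ _ hδδ₀ => ?_⟩
    filter_upwards [hev] with x hx
    exact le_trans (by exact_mod_cast card_cruxFilter_mono f hδδ₀ x) hx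
  · intro h k f hf ε hε
    obtain ⟨δ₀, hδ₀, hδ⟩ := h k f hf ε hε
    exact ⟨min δ₀ (1 / 4), by positivity, min_le_right _ _,
      hδ _ (by positivity) (min_le_left _ _)⟩

/-- **The `k = 0` slice of the crux is TRUE**: for the empty system the count is `#[1, x] = x`,
`polyPrimeCount = x + 1` and the tolerance is `ε·x`. [folklore] -/
theorem cruxConclusion_fin_zero (f : Fin 0 → ℤ[X]) (ε : ℝ) (hε : 0 < ε) :
    ∃ δ : ℝ, 0 < δ ∧ δ ≤ 1 / 4 ∧ ∀ᶠ x : ℕ in atTop,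
      (((Icc 1 x).filter (fun n : ℕ => ∀ i, 0 < (f i).eval (n : ℤ) ∧
        ∀ p ∈ range ⌈(x : ℝ) ^ (((f i).natDegree : ℝ) * (1 - δ) / 2)⌉₊,
          p.Prime → ¬ ((p : ℤ) ∣ (f i).eval (n : ℤ)))).card : ℝ) ≤
        (polyPrimeCount f x : ℝ) + ε * (x : ℝ) / Real.log x ^ 0 := by
  refine ⟨1 / 4, by norm_num, le_rfl, Eventually.of_forall fun x => ?_⟩
  have h1 : #((Icc 1 x).filter (fun n : ℕ => ∀ i, 0 < (f i).eval (n : ℤ) ∧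
      ∀ p ∈ range ⌈(x : ℝ) ^ (((f i).natDegree : ℝ) * (1 - 1 / 4) / 2)⌉₊,
        p.Prime → ¬ ((p : ℤ) ∣ (f i).eval (n : ℤ)))) ≤ x :=
    calc _ ≤ #(Icc 1 x) := card_filter_le _ _
      _ = x := by simp
  have h2 : polyPrimeCount f x = x + 1 := by
    unfold polyPrimeCount
    rw [Finset.filter_true_of_mem (fun n _ => fun i => i.elim0), card_range]
  rw [h2, pow_zero, div_one]
  have h1' : (#((Icc 1 x).filter (fun n : ℕ => ∀ i, 0 < (f i).eval (n : ℤ) ∧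
      ∀ p ∈ range ⌈(x : ℝ) ^ (((f i).natDegree : ℝ) * (1 - 1 / 4) / 2)⌉₊,
        p.Prime → ¬ ((p : ℤ) ∣ (f i).eval (n : ℤ)))) : ℝ) ≤ x := by exact_mod_cast h1
  have hx : (0 : ℝ) ≤ x := Nat.cast_nonneg x
  push_cast
  nlinarith

/-- Hence the crux reduces to systems with `k ≥ 1`. [folklore] -/
theorem balancedSemiprimeLayer_iff_pos :
    BalancedSemiprimeLayer ↔
      ∀ (k : ℕ) (f : Fin k → ℤ[X]), 0 < k → IsBatemanHornSystem f → ∀ ε : ℝ, 0 < ε →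
        ∃ δ : ℝ, 0 < δ ∧ δ ≤ 1 / 4 ∧ ∀ᶠ x : ℕ in atTop,
          (((Icc 1 x).filter (fun n : ℕ => ∀ i, 0 < (f i).eval (n : ℤ) ∧
            ∀ p ∈ range ⌈(x : ℝ) ^ (((f i).natDegree : ℝ) * (1 - δ) / 2)⌉₊,
              p.Prime → ¬ ((p : ℤ) ∣ (f i).eval (n : ℤ)))).card : ℝ) ≤
            (polyPrimeCount f x : ℝ) + ε * (x : ℝ) / Real.log x ^ k := by
  constructor
  · intro h k f _ hf
    exact h k f hf
  · intro h k f hf ε hε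
    rcases Nat.eq_zero_or_pos k with rfl | hk
    · exact cruxConclusion_fin_zero f ε hε
    · exact h k f hk hf ε hε

end Summit.Parity.BatemanHorn.Theorems.BalancedSemiprimeLayer.Negative
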